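import Summits.BirchSwinnertonDyer.BirchSwinnertonDyer.Theorems.ManinLocalTwoThreeKummerDiamondStepTwoCyclotomic
import Summits.BirchSwinnertonDyer.BirchSwinnertonDyer.Theorems.ManinLocalTwoThreeComplexAutCyclotomicValues
import Summits.BirchSwinnertonDyer.BirchSwinnertonDyer.Theorems.ManinLocalTwoThreeComplexAutGaussSum
import Summits.BirchSwinnertonDyer.BirchSwinnertonDyer.Theorems.ManinLocalTwoThreeComplexAutKummer
import HarnessLib

/-!
# Kummer witnesses for the square classes `2, −1, −2, −p` in the `σ(e^{2πi/N}) = e^{2πi d/N}` currency of `StepTwo.propositionA_complex`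
(route `ManinLocalTwoThree`, crux C2 `ManinOddAtFour` stmt-BirchSwinnertonDyer-22967; cell bsd-f2-manin, C2/C3 LEAD p1 gen 20;
`--supports stmt-BirchSwinnertonDyer-22967`; line card `Cruxes/ManinOddAtFour/Lines/kummer_diamond.md`, D5→D6→D7 bridge)

p2's `StepTwo.propositionA_complex` describes the two odd Kummer classes `h₁`, `h₂` of the index-`4` world by the residue of the cyclotomic
exponent `d` of `σ ∈ Aut(ℂ/ℚ)` (`σ(e^{2πi/N}) = e^{2πi d/N}`, `dd′ ≡ 1 (mod N)`): `h₂ σ = 0 ↔ d` is a square mod `p`, and `h₁ σ` depends exactly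
on `d mod 8`.  To READ these as square classes in `ℚˣ/ℚˣ²` (D7 input) one needs, in the same currency, complex numbers `g` with `g² = D`
for `D ∈ {2, −1, −2, −p}` whose fixed locus `{σ : σg = g}` is the corresponding set of residues:

* `exists_natExponent` — bridge to the `ℕ`-exponent currency `σ(ζ_N) = ζ_N^{d₀}` of the LEAD toolkit (`…ComplexAutCyclotomicValues`, `…GaussSum`);
* `exists_kummerWitness_two` (`√2`: `d ≡ ±1 (8)`), `exists_kummerWitness_neg_one` (`i`: `d ≡ 1, 5 (8)`), `exists_kummerWitness_neg_two`
  (`i√2`: `d ≡ 1, 3 (8)`) — for `8 ∣ N`; `exists_kummerWitness_neg_prime` (the quadratic Gauss sum `g_p`, `g_p² = −p` for `p ≡ 3 (4)`,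
  `σ g_p = g_p ↔ d` square mod `p`) — for an odd prime `p ∣ N`;
* `sqClass_eq_of_fixed_iff` — Kummer theory over `ℚ` inside `ℂ`: if `w² = δ`, `g² = D` (`δ, D ∈ ℚˣ`) and `σw = w ↔ σg = g` for all
  `σ ∈ Aut(ℂ/ℚ)`, then `δ ≡ D` mod squares (LEAD p761015 `sqClass_eq_of_forall_kummer_eq`).

UNCONDITIONAL; no definitions, no sorry.  Nothing about E-es-185, C2, Manin's conjecture or BSD is proved here.
[cite: Lang2002, Ch. VI §3 (Gauss sums), Ch. VI §8 (Kummer theory)] [cite: SilvermanAEC2009, Thm. X.1.1]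
-/

set_option autoImplicit false
-- lint-debt: the directory name repeats the summit name (sibling precedent `ManinLocalTwoThreeKummerDiamondStepTwoCyclotomic.lean`)
set_option linter.dupNamespace false

noncomputable section

open scoped Classical
open Complex WeierstrassCurve.Affine

namespace Summit.BirchSwinnertonDyer.BirchSwinnertonDyer.Theorems.ManinLocalTwoThree.CyclotomicSigns

variable {N : ℕ} [NeZero N]

/-! ## §1 From the `ℤ`-exponent of `propositionA_complex` to the `ℕ`-exponent of the toolkit -/

/-- **`ℕ`-exponent.**  If `σ(e^{2πi/N}) = e^{2πi d/N}` with `dd′ ≡ 1 (mod N)`, then `σ(ζ_N) = ζ_N^{d₀}` for a natural number `d₀ ≡ d (mod N)`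
coprime to `N`. [folklore] -/
theorem exists_natExponent {σ : ℂ ≃ₐ[ℚ] ℂ} {d d' : ℤ} (hdd' : ((d * d' : ℤ) : ZMod N) = 1)
    (hσ : σ (exp (2 * Real.pi * I / N)) = exp (2 * Real.pi * I * d / N)) :
    ∃ d₀ : ℕ, σ (exp (2 * Real.pi * I / N)) = exp (2 * Real.pi * I / N) ^ d₀ ∧ ((d₀ : ℤ) : ZMod N) = (d : ZMod N) ∧
      d₀.Coprime N := by
  have hN : N ≠ 0 := NeZero.ne N
  set n : ℕ := (d % N).toNat with hn
  have hn0 : (0 : ℤ) ≤ d % N := Int.emod_nonneg d (by exact_mod_cast hN)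
  have hnd : ((n : ℤ) : ZMod N) = (d : ZMod N) := by
    rw [hn, Int.toNat_of_nonneg hn0, ZMod.intCast_eq_intCast_iff_dvd_sub]
    exact ⟨d / N, by linear_combination (-1 : ℤ) * Int.emod_add_ediv_mul d N⟩
  have hdcop : IsCoprime d (N : ℤ) := by
    obtain ⟨k, hk⟩ := (ZMod.intCast_eq_intCast_iff_dvd_sub (d * d') 1 N).mp (by rw [hdd', Int.cast_one])
    exact ⟨d', k, by linear_combination -hk⟩
  have hcop : n.Coprime N := by
    have h1 : IsCoprime (n : ℤ) (N : ℤ) := by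
      obtain ⟨u, v, huv⟩ := hdcop
      obtain ⟨k, hk⟩ := (ZMod.intCast_eq_intCast_iff_dvd_sub n d N).mp hnd
      exact ⟨u, v + u * k, by linear_combination huv - u * hk⟩
    exact Nat.isCoprime_iff_coprime.mp h1
  refine ⟨n, ?_, hnd, hcop⟩
  rw [hσ, StepTwo.exp_two_pi_I_div_pow_natCast, StepTwo.exp_two_pi_I_mul_div_eq_of_cast_eq hnd]

omit [NeZero N] in
/-- Residues mod `8` from residues mod `N` when `8 ∣ N`. [folklore] -/
theorem zmod_eight_eq_of_zmod_eq (h8 : 8 ∣ N) {a b : ℤ} (h : (a : ZMod N) = (b : ZMod N)) : (a : ZMod 8) = (b : ZMod 8) := by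
  rw [ZMod.intCast_eq_intCast_iff_dvd_sub] at h ⊢
  exact (Int.natCast_dvd_natCast.mpr h8).trans h

omit [NeZero N] in
/-- An exponent coprime to `N` with `8 ∣ N` is odd: its residue mod `8` is `1, 3, 5` or `7`. [folklore] -/
theorem mod_eight_of_coprime (h8 : 8 ∣ N) {d₀ : ℕ} (hcop : d₀.Coprime N) :
    d₀ % 8 = 1 ∨ d₀ % 8 = 3 ∨ d₀ % 8 = 5 ∨ d₀ % 8 = 7 := by
  have h2 : ¬ 2 ∣ d₀ := by
    intro h
    have := Nat.Coprime.coprime_dvd_right ((show (2 : ℕ) ∣ 8 by norm_num).trans h8) hcop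
    rw [Nat.coprime_two_right] at this
    exact (Nat.not_even_iff_odd.mpr this) (even_iff_two_dvd.mpr h)
  omega

/-- `(d₀ : ZMod 8) = k ↔ d₀ % 8 = k` for a numeral `k < 8`. [folklore] -/
theorem natCast_zmod_eight_eq_iff (d₀ k : ℕ) (hk : k < 8) : ((d₀ : ℤ) : ZMod 8) = (k : ZMod 8) ↔ d₀ % 8 = k := by
  rw [Int.cast_natCast, ZMod.natCast_eq_natCast_iff', Nat.mod_eq_of_lt hk]

/-! ## §2 Kummer theory: equal fixed loci give equal square classes -/

/-- **Equal Galois stabilisers ⟹ equal square classes.**  If `w² = δ`, `g² = D` with `δ, D ∈ ℚˣ` and for every `σ ∈ Aut(ℂ/ℚ)`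
`σw = w ↔ σg = g`, then `sqClass δ = sqClass D` (`σ` acts on `w`, `g` by signs, and equal signs give `σ(w)·g = w·σ(g)`; LEAD
`sqClass_eq_of_forall_kummer_eq`). [cite: Lang2002, Ch. VI §8] -/
theorem sqClass_eq_of_fixed_iff {δ D : ℚ} (hδ : δ ≠ 0) (hD : D ≠ 0) {w g : ℂ} (hw : w ^ 2 = (δ : ℂ)) (hg : g ^ 2 = (D : ℂ))
    (h : ∀ σ : ℂ ≃ₐ[ℚ] ℂ, σ w = w ↔ σ g = g) : sqClass δ = sqClass D := by
  refine ComplexAut.sqClass_eq_of_forall_kummer_eq hδ hD hw hg fun σ ↦ ?_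
  have hw' : σ w = w ∨ σ w = -w := by
    rw [← sq_eq_sq_iff_eq_or_eq_neg, ← map_pow, hw, map_ratCast]
  have hg' : σ g = g ∨ σ g = -g := by
    rw [← sq_eq_sq_iff_eq_or_eq_neg, ← map_pow, hg, map_ratCast]
  have hg0 : g ≠ 0 := by
    intro h0; rw [h0, zero_pow two_ne_zero] at hg; exact hD (by exact_mod_cast hg.symm)
  have hw0 : w ≠ 0 := by
    intro h0; rw [h0, zero_pow two_ne_zero] at hw; exact hδ (by exact_mod_cast hw.symm)
  rcases hw' with hw' | hw'
  · rw [hw', (h σ).mp hw']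
  · have hg'' : σ g = -g := by
      rcases hg' with hg' | hg'
      · exfalso
        have := (h σ).mpr hg'
        rw [this] at hw'
        exact hw0 (by linear_combination hw' / 2)
      · exact hg'
    rw [hw', hg'']; ring

/-! ## §3 The witnesses for `2`, `−1`, `−2` (`8 ∣ N`) -/

/-- **Kummer witness for `2`:** `σ(√2) = √2 ↔ d ≡ ±1 (mod 8)`. [cite: Lang2002, Ch. VI §3] -/
theorem exists_kummerWitness_two (h8 : 8 ∣ N) :
    ∃ g : ℂ, g ^ 2 = ((2 : ℚ) : ℂ) ∧ ∀ (σ : ℂ ≃ₐ[ℚ] ℂ) (d d' : ℤ), ((d * d' : ℤ) : ZMod N) = 1 →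
      σ (exp (2 * Real.pi * I / N)) = exp (2 * Real.pi * I * d / N) →
        (σ g = g ↔ ((d : ZMod 8) = 1 ∨ (d : ZMod 8) = 7)) := by
  have hN : N ≠ 0 := NeZero.ne N
  refine ⟨(Real.sqrt 2 : ℂ), by rw [Rat.cast_ofNat, ← ofReal_pow, Real.sq_sqrt (by norm_num)]; norm_num, fun σ d d' hdd' hσ ↦ ?_⟩
  obtain ⟨d₀, hσ₀, hd₀, hcop⟩ := exists_natExponent hdd' hσ
  have hval := ComplexAut.algEquiv_sqrt_two_of_mod_eight σ hN h8 hσ₀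
  have h8' := zmod_eight_eq_of_zmod_eq h8 hd₀
  have hsqrt0 : (Real.sqrt 2 : ℂ) ≠ 0 := by
    rw [Ne, ofReal_eq_zero]; exact Real.sqrt_ne_zero'.mpr (by norm_num)
  rw [← h8']
  rcases mod_eight_of_coprime h8 hcop with h | h | h | h
  · exact ⟨fun _ ↦ Or.inl ((natCast_zmod_eight_eq_iff d₀ 1 (by norm_num)).mpr h), fun _ ↦ hval.1 (Or.inl h)⟩
  · refine ⟨fun hfix ↦ ?_, fun h' ↦ ?_⟩
    · exfalso; rw [hval.2 (Or.inl h)] at hfix; exact hsqrt0 (by linear_combination -hfix / 2)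
    · exfalso; rcases h' with h' | h'
      · have := (natCast_zmod_eight_eq_iff d₀ 1 (by norm_num)).mp h'; omega
      · have := (natCast_zmod_eight_eq_iff d₀ 7 (by norm_num)).mp (by exact_mod_cast h'); omega
  · refine ⟨fun hfix ↦ ?_, fun h' ↦ ?_⟩
    · exfalso; rw [hval.2 (Or.inr h)] at hfix; exact hsqrt0 (by linear_combination -hfix / 2)
    · exfalso; rcases h' with h' | h'
      · have := (natCast_zmod_eight_eq_iff d₀ 1 (by norm_num)).mp h'; omega
      · have := (natCast_zmod_eight_eq_iff d₀ 7 (by norm_num)).mp (by exact_mod_cast h'); omega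
  · exact ⟨fun _ ↦ Or.inr (by exact_mod_cast (natCast_zmod_eight_eq_iff d₀ 7 (by norm_num)).mpr h),
      fun _ ↦ hval.1 (Or.inr h)⟩

/-- **Kummer witness for `−1`:** `σ(i) = i ↔ d ≡ 1 (mod 4)`, i.e. `d ≡ 1, 5 (mod 8)`. [cite: Lang2002, Ch. VI §3] -/
theorem exists_kummerWitness_neg_one (h8 : 8 ∣ N) :
    ∃ g : ℂ, g ^ 2 = ((-1 : ℚ) : ℂ) ∧ ∀ (σ : ℂ ≃ₐ[ℚ] ℂ) (d d' : ℤ), ((d * d' : ℤ) : ZMod N) = 1 →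
      σ (exp (2 * Real.pi * I / N)) = exp (2 * Real.pi * I * d / N) →
        (σ g = g ↔ ((d : ZMod 8) = 1 ∨ (d : ZMod 8) = 5)) := by
  have hN : N ≠ 0 := NeZero.ne N
  have h4 : 4 ∣ N := (show (4 : ℕ) ∣ 8 by norm_num).trans h8
  refine ⟨I, by push_cast; exact I_sq, fun σ d d' hdd' hσ ↦ ?_⟩
  obtain ⟨d₀, hσ₀, hd₀, hcop⟩ := exists_natExponent hdd' hσ
  have hval := ComplexAut.algEquiv_I_of_mod_four σ hN h4 hσ₀
  have h8' := zmod_eight_eq_of_zmod_eq h8 hd₀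
  rw [← h8']
  rcases mod_eight_of_coprime h8 hcop with h | h | h | h
  · exact ⟨fun _ ↦ Or.inl ((natCast_zmod_eight_eq_iff d₀ 1 (by norm_num)).mpr h), fun _ ↦ hval.1 (by omega)⟩
  · refine ⟨fun hfix ↦ ?_, fun h' ↦ ?_⟩
    · exfalso; rw [hval.2 (by omega)] at hfix; exact I_ne_zero (by linear_combination -hfix / 2)
    · exfalso; rcases h' with h' | h'
      · have := (natCast_zmod_eight_eq_iff d₀ 1 (by norm_num)).mp h'; omega
      · have := (natCast_zmod_eight_eq_iff d₀ 5 (by norm_num)).mp (by exact_mod_cast h'); omega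
  · exact ⟨fun _ ↦ Or.inr (by exact_mod_cast (natCast_zmod_eight_eq_iff d₀ 5 (by norm_num)).mpr h),
      fun _ ↦ hval.1 (by omega)⟩
  · refine ⟨fun hfix ↦ ?_, fun h' ↦ ?_⟩
    · exfalso; rw [hval.2 (by omega)] at hfix; exact I_ne_zero (by linear_combination -hfix / 2)
    · exfalso; rcases h' with h' | h'
      · have := (natCast_zmod_eight_eq_iff d₀ 1 (by norm_num)).mp h'; omega
      · have := (natCast_zmod_eight_eq_iff d₀ 5 (by norm_num)).mp (by exact_mod_cast h'); omega

/-- **Kummer witness for `−2`:** `σ(i√2) = i√2 ↔ d ≡ 1, 3 (mod 8)`. [cite: Lang2002, Ch. VI §3] -/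
theorem exists_kummerWitness_neg_two (h8 : 8 ∣ N) :
    ∃ g : ℂ, g ^ 2 = ((-2 : ℚ) : ℂ) ∧ ∀ (σ : ℂ ≃ₐ[ℚ] ℂ) (d d' : ℤ), ((d * d' : ℤ) : ZMod N) = 1 →
      σ (exp (2 * Real.pi * I / N)) = exp (2 * Real.pi * I * d / N) →
        (σ g = g ↔ ((d : ZMod 8) = 1 ∨ (d : ZMod 8) = 3)) := by
  have hN : N ≠ 0 := NeZero.ne N
  have h4 : 4 ∣ N := (show (4 : ℕ) ∣ 8 by norm_num).trans h8
  have hsq2 : ((Real.sqrt 2 : ℂ)) ^ 2 = 2 := by rw [← ofReal_pow, Real.sq_sqrt (by norm_num)]; norm_num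
  have hsqrt0 : (Real.sqrt 2 : ℂ) ≠ 0 := by
    rw [Ne, ofReal_eq_zero]; exact Real.sqrt_ne_zero'.mpr (by norm_num)
  have hg0 : I * (Real.sqrt 2 : ℂ) ≠ 0 := mul_ne_zero I_ne_zero hsqrt0
  refine ⟨I * (Real.sqrt 2 : ℂ), by rw [mul_pow, I_sq, hsq2]; push_cast; ring, fun σ d d' hdd' hσ ↦ ?_⟩
  obtain ⟨d₀, hσ₀, hd₀, hcop⟩ := exists_natExponent hdd' hσ
  have hI := ComplexAut.algEquiv_I_of_mod_four σ hN h4 hσ₀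
  have h2 := ComplexAut.algEquiv_sqrt_two_of_mod_eight σ hN h8 hσ₀
  have h8' := zmod_eight_eq_of_zmod_eq h8 hd₀
  rw [← h8', map_mul]
  rcases mod_eight_of_coprime h8 hcop with h | h | h | h
  · rw [hI.1 (by omega), h2.1 (Or.inl h)]
    exact ⟨fun _ ↦ Or.inl ((natCast_zmod_eight_eq_iff d₀ 1 (by norm_num)).mpr h), fun _ ↦ rfl⟩
  · rw [hI.2 (by omega), h2.2 (Or.inl h)]
    exact ⟨fun _ ↦ Or.inr (by exact_mod_cast (natCast_zmod_eight_eq_iff d₀ 3 (by norm_num)).mpr h), fun _ ↦ by ring⟩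
  · rw [hI.1 (by omega), h2.2 (Or.inr h)]
    refine ⟨fun hfix ↦ ?_, fun h' ↦ ?_⟩
    · exfalso; exact hg0 (by linear_combination -hfix / 2)
    · exfalso; rcases h' with h' | h'
      · have := (natCast_zmod_eight_eq_iff d₀ 1 (by norm_num)).mp h'; omega
      · have := (natCast_zmod_eight_eq_iff d₀ 3 (by norm_num)).mp (by exact_mod_cast h'); omega
  · rw [hI.2 (by omega), h2.1 (Or.inr h)]
    refine ⟨fun hfix ↦ ?_, fun h' ↦ ?_⟩
    · exfalso; exact hg0 (by linear_combination -hfix / 2)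
    · exfalso; rcases h' with h' | h'
      · have := (natCast_zmod_eight_eq_iff d₀ 1 (by norm_num)).mp h'; omega
      · have := (natCast_zmod_eight_eq_iff d₀ 3 (by norm_num)).mp (by exact_mod_cast h'); omega

/-! ## §4 The witness for `−p`, `p ≡ 3 (mod 4)` an odd prime dividing `N`: the quadratic Gauss sum -/

/-- **Kummer witness for `−p`:** for an odd prime `p ∣ N` with `p ≡ 3 (mod 4)`, the quadratic Gauss sum `g_p` has `g_p² = −p` and
`σ(g_p) = g_p ↔ d` is a square mod `p` (`σ g_p = (d/p) g_p`). [cite: Lang2002, Ch. VI §3] -/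
theorem exists_kummerWitness_neg_prime {p : ℕ} (hp : p.Prime) (hp4 : p % 4 = 3) (hpN : p ∣ N) :
    ∃ g : ℂ, g ^ 2 = ((-(p : ℚ) : ℚ) : ℂ) ∧ ∀ (σ : ℂ ≃ₐ[ℚ] ℂ) (d d' : ℤ), ((d * d' : ℤ) : ZMod N) = 1 →
      σ (exp (2 * Real.pi * I / N)) = exp (2 * Real.pi * I * d / N) →
        (σ g = g ↔ IsSquare (d : ZMod p)) := by
  haveI : Fact p.Prime := ⟨hp⟩
  have hN : N ≠ 0 := NeZero.ne N
  have hp2 : p ≠ 2 := by rintro rfl; norm_num at hp4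
  have hp0 : p ≠ 0 := hp.ne_zero
  set χ := (quadraticChar (ZMod p)).ringHomComp (Int.castRingHom ℂ) with hχ
  set g := gaussSum χ (ZMod.stdAddChar (N := p)) with hg
  -- `g² = −p`
  have hchar : ringChar (ZMod p) ≠ 2 := by rw [ZMod.ringChar_zmod_n]; exact hp2
  have hneg1 : χ (-1) = -1 := by
    rw [hχ, MulChar.ringHomComp_apply, quadraticChar_neg_one hchar, ZMod.card p, ZMod.χ₄_nat_three_mod_four hp4]
    simp
  have hg2 : g ^ 2 = ((-(p : ℚ) : ℚ) : ℂ) := by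
    rw [hg, ComplexAut.gaussSum_quadratic_sq hp2, ← hχ, hneg1]; push_cast; ring
  have hg0 : g ≠ 0 := by
    intro h0; rw [h0, zero_pow two_ne_zero] at hg2
    push_cast at hg2
    have : (p : ℂ) = 0 := by linear_combination hg2
    exact hp0 (by exact_mod_cast this)
  refine ⟨g, hg2, fun σ d d' hdd' hσ ↦ ?_⟩
  obtain ⟨d₀, hσ₀, hd₀, hcop⟩ := exists_natExponent hdd' hσ
  -- `σ(ζ_p) = ζ_p^{d₀}` from `ζ_p = ζ_N^{N/p}`
  obtain ⟨m, hm⟩ := hpN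
  have hm0 : m ≠ 0 := by rintro rfl; exact hN (by rw [hm, mul_zero])
  have hζ : exp (2 * Real.pi * I / p) = exp (2 * Real.pi * I / N) ^ m := by
    rw [← exp_nat_mul]; congr 1; rw [hm]; push_cast; field_simp
  have hσp : σ (exp (2 * Real.pi * I / p)) = exp (2 * Real.pi * I / p) ^ d₀ := by
    rw [hζ, map_pow, hσ₀, ← pow_mul, ← pow_mul, Nat.mul_comm d₀ m]
  have hcopp : d₀.Coprime p := Nat.Coprime.coprime_dvd_right ⟨m, hm⟩ hcop
  have hval := ComplexAut.algEquiv_gaussSum_quadratic σ hcopp hσp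
  rw [← hχ, ← hg] at hval
  -- `(d₀ : ZMod p) = (d : ZMod p)` and `χ(d₀) = 1 ↔ d₀` square
  have hdp : ((d₀ : ℕ) : ZMod p) = (d : ZMod p) := by
    have h1 : ((d₀ : ℤ) : ZMod p) = (d : ZMod p) := by
      rw [ZMod.intCast_eq_intCast_iff_dvd_sub] at hd₀ ⊢
      exact (Int.natCast_dvd_natCast.mpr ⟨m, hm⟩).trans hd₀
    exact_mod_cast h1
  have hd₀0 : ((d₀ : ℕ) : ZMod p) ≠ 0 := by
    rw [Ne, ZMod.natCast_eq_zero_iff]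
    intro h
    have := Nat.Coprime.eq_one_of_dvd hcopp.symm h
    exact hp.one_lt.ne' this
  rw [hval, ← hdp]
  constructor
  · intro h
    have h1 : χ (d₀ : ZMod p) = 1 := by
      have : (χ (d₀ : ZMod p) - 1) * g = 0 := by linear_combination h
      rcases mul_eq_zero.mp this with h' | h'
      · linear_combination h'
      · exact absurd h' hg0
    have h1' : quadraticChar (ZMod p) (d₀ : ZMod p) = 1 := by
      rw [hχ, MulChar.ringHomComp_apply, eq_intCast] at h1
      exact_mod_cast h1
    exact (quadraticChar_one_iff_isSquare hd₀0).mp h1'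
  · intro h
    have h1' : quadraticChar (ZMod p) (d₀ : ZMod p) = 1 := (quadraticChar_one_iff_isSquare hd₀0).mpr h
    rw [hχ, MulChar.ringHomComp_apply, h1']
    simp

end Summit.BirchSwinnertonDyer.BirchSwinnertonDyer.Theorems.ManinLocalTwoThree.CyclotomicSigns

end
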